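import Summits.AtomisticToContinuum.FouriersLaw.Theorems.BondHeatUncertaintySubdiffusiveBondHeatKernelDetailedBalanceLaplaceA

/-!
# `HonestZwanzig.FeshbachIdentities`, part 2: positivity of the static covariance matrix

Support file for item `stmt-AtomisticToContinuum-12697` (`HonestZwanzig.FeshbachIdentities`), clause (iv-a):
for the pinned anharmonic chain `P = pinnedChain ω₂ lam β γ` (`ω₂ > 0`, `lam, β ≥ 0`), `T > 0`, the Gibbs measure
`μ_T = gibbsMeasure N T` and a finite family of NICE observables `e_x` (continuous, `|e_x| ≤ C e^{ϑH}`, `2ϑ < 1/T`),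
the covariance matrix `Cov(e_x, e_y) = ∫ e_x e_y dμ_T - μ_T(e_x) μ_T(e_y)` is positive definite as soon as no
non-trivial combination `∑ ξ_x e_x` is constant:

* `pinnedChain_integral_gibbsMeasure_pos` — a continuous nonnegative observable which is positive somewhere has
  positive `μ_T`-integral (`μ_T` has the everywhere positive Lebesgue density `Z⁻¹e^{-H/T}`);
* `pinnedChain_sum_cov_eq_integral_sq_sub` — `ξᵀ Cov(e,e) ξ = ∫ (u - μ_T u)² dμ_T`, `u = ∑ ξ_x e_x`;
* `pinnedChain_sum_cov_pos` — hence `ξᵀ Cov(e,e) ξ > 0` whenever `u` takes two different values.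

The verification that the symmetrically split site energies of the route are nice and that `∑ ξ_x e_x` is
non-constant for `ξ ≠ 0` is in the site-energy file.
-/

noncomputable section

open MeasureTheory ProbabilityTheory Filter Topology Set Function
open scoped NNReal ENNReal
open Literature.MathematicalPhysics.KineticTheory.HeatConduction
open Literature.MathematicalPhysics.KineticTheory OscillatorChain
open Summit.AtomisticToContinuum.FouriersLaw.Theorems.SubdiffusiveBondHeat
open Summit.AtomisticToContinuum.FouriersLaw.Theorems.OddSectorIrreversibility

namespace Summit.AtomisticToContinuum.FouriersLaw.Theorems.HonestZwanzig

variable {N : ℕ}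

section Pinned

variable {ω₂ lam β γ : ℝ} (hω : 0 < ω₂) (hl : 0 ≤ lam) (hβ : 0 ≤ β) {T : ℝ} (hT : 0 < T)
include hω hl hβ hT

/-! ### Positivity of Gibbs integrals -/

/-- **`μ_T` charges every observable that is positive somewhere**: for a continuous `F ≥ 0` with `F(z₀) > 0` and
`F e^{-H/T} ∈ L¹(dq dp)`, `0 < ∫ F dμ_T` (`μ_T = (∫e^{-H/T})⁻¹ e^{-H/T} dq dp`, the density is positive and
Lebesgue measure charges the open set `{F > 0}`). [folklore] -/
theorem pinnedChain_integral_gibbsMeasure_pos {F : PhaseSpace N → ℝ} (hF : Continuous F) (hF0 : ∀ z, 0 ≤ F z)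
    {z₀ : PhaseSpace N} (hz₀ : 0 < F z₀)
    (hFint : Integrable (fun x => F x * (pinnedChain ω₂ lam β γ).gibbsDensity N T x)) :
    0 < ∫ z, F z ∂((pinnedChain ω₂ lam β γ).gibbsMeasure N T) := by
  set P := pinnedChain ω₂ lam β γ with hP
  rw [P.integral_gibbsMeasure]
  have hZ : 0 < ∫ x, P.gibbsDensity N T x := integral_exp_pos (pinnedChain_integrable_gibbsDensity hω hl hβ γ N hT)
  refine mul_pos (inv_pos.2 hZ) ?_
  haveI : (volume : Measure (PhaseSpace N)).IsOpenPosMeasure := by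
    have h1 : (volume : Measure (Fin N → ℝ)).IsOpenPosMeasure := by rw [volume_pi]; infer_instance
    rw [Measure.volume_eq_prod]
    infer_instance
  refine (integral_pos_iff_support_of_nonneg (fun x => mul_nonneg (hF0 x) (P.gibbsDensity_pos N T x).le)
    hFint).2 ?_
  have hopen : IsOpen (F ⁻¹' Ioi 0) := isOpen_Ioi.preimage hF
  have hsub : F ⁻¹' Ioi 0 ⊆ Function.support fun x => F x * P.gibbsDensity N T x := by
    intro x hx
    exact Function.mem_support.2 (mul_ne_zero (ne_of_gt hx) (P.gibbsDensity_pos N T x).ne')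
  exact (hopen.measure_pos volume ⟨z₀, hz₀⟩).trans_le (measure_mono hsub)

/-! ### The quadratic form of the covariance matrix -/

omit hω hl hβ hT in
/-- A finite combination of nice observables is nice. [folklore] -/
theorem abs_sum_mul_le_exp_bound {ι : Type*} (s : Finset ι) {ϑ : ℝ} {e : ι → PhaseSpace N → ℝ} {C : ℝ}
    (heb : ∀ i y, |e i y| ≤ C * Real.exp (ϑ * (pinnedChain ω₂ lam β γ).hamiltonian N y)) (ξ : ι → ℝ)
    (y : PhaseSpace N) :
    |∑ i ∈ s, ξ i * e i y| ≤ (∑ i ∈ s, |ξ i| * C) * Real.exp (ϑ * (pinnedChain ω₂ lam β γ).hamiltonian N y) := by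
  rw [Finset.sum_mul]
  refine (Finset.abs_sum_le_sum_abs _ _).trans (Finset.sum_le_sum fun i _ => ?_)
  rw [abs_mul, mul_assoc]
  exact mul_le_mul_of_nonneg_left (heb i y) (abs_nonneg _)

/-- **`ξᵀ Cov(e,e) ξ = ∫ (u - μ_T(u))² dμ_T`** with `u = ∑_x ξ_x e_x`, for nice `e_x` (`2ϑ < 1/T`). [folklore] -/
theorem pinnedChain_sum_cov_eq_integral_sq_sub {ϑ : ℝ} (h2ϑ : 2 * ϑ < 1 / T)
    {e : Fin N → PhaseSpace N → ℝ} (he : ∀ x, Continuous (e x)) {C : ℝ} (hC : 0 ≤ C)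
    (heb : ∀ x y, |e x y| ≤ C * Real.exp (ϑ * (pinnedChain ω₂ lam β γ).hamiltonian N y)) (ξ : Fin N → ℝ) :
    ∑ x, ∑ y, ξ x * ((∫ z, e x z * e y z ∂((pinnedChain ω₂ lam β γ).gibbsMeasure N T)) -
        (∫ z, e x z ∂((pinnedChain ω₂ lam β γ).gibbsMeasure N T)) *
          (∫ z, e y z ∂((pinnedChain ω₂ lam β γ).gibbsMeasure N T))) * ξ y =
      ∫ z, ((∑ x, ξ x * e x z) - ∫ w, (∑ x, ξ x * e x w) ∂((pinnedChain ω₂ lam β γ).gibbsMeasure N T)) ^ 2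
        ∂((pinnedChain ω₂ lam β γ).gibbsMeasure N T) := by
  set P := pinnedChain ω₂ lam β γ with hP
  set μ := P.gibbsMeasure N T with hμ
  haveI : IsProbabilityMeasure μ := pinnedChain_isProbabilityMeasure_gibbsMeasure hω hl hβ γ N hT
  have hϑ1 : ϑ < 1 / T := by
    have : ϑ ≤ 2 * ϑ ∨ 2 * ϑ < ϑ := le_or_gt _ _
    rcases this with h | h
    · exact lt_of_le_of_lt h h2ϑ
    · -- `ϑ < 0`
      have hϑ : ϑ < 0 := by linarith
      exact hϑ.trans (by positivity)
  have hEint : Integrable (fun z => Real.exp (ϑ * P.hamiltonian N z)) μ :=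
    pinnedChain_integrable_exp_mul_hamiltonian_gibbsMeasure hω hl hβ γ N hT hϑ1
  have hE2int : Integrable (fun z => Real.exp (2 * ϑ * P.hamiltonian N z)) μ :=
    pinnedChain_integrable_exp_mul_hamiltonian_gibbsMeasure hω hl hβ γ N hT h2ϑ
  have hei : ∀ x, Integrable (e x) μ := fun x => integrable_of_abs_le_exp hEint (he x) (heb x)
  have heij : ∀ x y, Integrable (fun z => e x z * e y z) μ := fun x y =>
    integrable_of_abs_le_exp (C := C * C) hE2int ((he x).mul (he y)) (fun z => by
      rw [abs_mul, show C * C * Real.exp (2 * ϑ * P.hamiltonian N z) =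
        (C * Real.exp (ϑ * P.hamiltonian N z)) * (C * Real.exp (ϑ * P.hamiltonian N z)) by
          rw [show 2 * ϑ * P.hamiltonian N z = ϑ * P.hamiltonian N z + ϑ * P.hamiltonian N z by ring,
            Real.exp_add]; ring]
      exact mul_le_mul (heb x z) (heb y z) (abs_nonneg _) (by positivity))
  -- the combination `u` and its mean
  set u : PhaseSpace N → ℝ := fun z => ∑ x, ξ x * e x z with hu
  set m : ℝ := ∫ w, u w ∂μ with hm
  have huc : Continuous u := continuous_finsetSum _ fun x _ => continuous_const.mul (he x)
  have hui : Integrable u μ := integrable_finsetSum _ fun x _ => (hei x).const_mul _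
  have hu2 : Integrable (fun z => u z ^ 2) μ := by
    have : (fun z => u z ^ 2) = fun z => ∑ x, ∑ y, (ξ x * ξ y) * (e x z * e y z) := by
      funext z
      simp only [hu, sq, Finset.sum_mul, Finset.mul_sum]
      refine Finset.sum_congr rfl fun x _ => Finset.sum_congr rfl fun y _ => by ring
    rw [this]
    exact integrable_finsetSum _ fun x _ => integrable_finsetSum _ fun y _ => (heij x y).const_mul _
  -- left-hand side `= ∫ u² - m²`
  have hmx : m = ∑ x, ξ x * ∫ z, e x z ∂μ := by
    simp only [hm, hu]
    rw [integral_finsetSum _ fun x _ => (hei x).const_mul _]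
    exact Finset.sum_congr rfl fun x _ => integral_const_mul _ _
  have hL : ∑ x, ∑ y, ξ x * ((∫ z, e x z * e y z ∂μ) - (∫ z, e x z ∂μ) * (∫ z, e y z ∂μ)) * ξ y =
      (∫ z, u z ^ 2 ∂μ) - m ^ 2 := by
    have h1 : ∫ z, u z ^ 2 ∂μ = ∑ x, ∑ y, ξ x * ξ y * ∫ z, e x z * e y z ∂μ := by
      have : (fun z => u z ^ 2) = fun z => ∑ x, ∑ y, (ξ x * ξ y) * (e x z * e y z) := by
        funext z
        simp only [hu, sq, Finset.sum_mul, Finset.mul_sum]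
        refine Finset.sum_congr rfl fun x _ => Finset.sum_congr rfl fun y _ => by ring
      rw [this, integral_finsetSum _ fun x _ => integrable_finsetSum _ fun y _ => (heij x y).const_mul _]
      refine Finset.sum_congr rfl fun x _ => ?_
      rw [integral_finsetSum _ fun y _ => (heij x y).const_mul _]
      exact Finset.sum_congr rfl fun y _ => integral_const_mul _ _
    have h2 : m ^ 2 = ∑ x, ∑ y, ξ x * ξ y * ((∫ z, e x z ∂μ) * (∫ z, e y z ∂μ)) := by
      rw [hmx, sq, Finset.sum_mul]
      refine Finset.sum_congr rfl fun x _ => ?_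
      rw [Finset.mul_sum]
      exact Finset.sum_congr rfl fun y _ => by ring
    rw [h1, h2, ← Finset.sum_sub_distrib]
    refine Finset.sum_congr rfl fun x _ => ?_
    rw [← Finset.sum_sub_distrib]
    exact Finset.sum_congr rfl fun y _ => by ring
  -- right-hand side `= ∫ u² - m²`
  have hR : ∫ z, (u z - m) ^ 2 ∂μ = (∫ z, u z ^ 2 ∂μ) - m ^ 2 := by
    have e1 : (fun z => (u z - m) ^ 2) = fun z => u z ^ 2 - (2 * m) * u z + m ^ 2 := by
      funext z; ring
    have i1 : Integrable (fun z => u z ^ 2 - 2 * m * u z) μ := hu2.sub (hui.const_mul _)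
    rw [e1, integral_add i1 (integrable_const _), integral_sub hu2 (hui.const_mul _),
      integral_const_mul, integral_const]
    simp only [probReal_univ, smul_eq_mul, one_mul]
    rw [← hm]
    ring
  rw [hL, ← hR]

/-- **Positive definiteness of the covariance matrix**: with `e_x` nice (`2ϑ < 1/T`), if `u = ∑ ξ_x e_x` takes two
different values then `ξᵀ Cov(e,e) ξ > 0` — it equals `∫ (u - μ_T u)² dμ_T`, the integrand is continuous,
nonnegative and positive at one of the two points, and `μ_T` charges open sets. [folklore] -/
theorem pinnedChain_sum_cov_pos {ϑ : ℝ} (hϑ0 : 0 < ϑ) (h2ϑ : 2 * ϑ < 1 / T)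
    {e : Fin N → PhaseSpace N → ℝ} (he : ∀ x, Continuous (e x)) {C : ℝ} (hC : 0 ≤ C)
    (heb : ∀ x y, |e x y| ≤ C * Real.exp (ϑ * (pinnedChain ω₂ lam β γ).hamiltonian N y)) (ξ : Fin N → ℝ)
    {z₀ z₁ : PhaseSpace N} (hne : ∑ x, ξ x * e x z₀ ≠ ∑ x, ξ x * e x z₁) :
    0 < ∑ x, ∑ y, ξ x * ((∫ z, e x z * e y z ∂((pinnedChain ω₂ lam β γ).gibbsMeasure N T)) -
        (∫ z, e x z ∂((pinnedChain ω₂ lam β γ).gibbsMeasure N T)) *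
          (∫ z, e y z ∂((pinnedChain ω₂ lam β γ).gibbsMeasure N T))) * ξ y := by
  set P := pinnedChain ω₂ lam β γ with hP
  set μ := P.gibbsMeasure N T with hμ
  rw [pinnedChain_sum_cov_eq_integral_sq_sub hω hl hβ hT h2ϑ he hC heb ξ]
  set u : PhaseSpace N → ℝ := fun z => ∑ x, ξ x * e x z with hu
  set m : ℝ := ∫ w, u w ∂μ with hm
  have huc : Continuous u := continuous_finsetSum _ fun x _ => continuous_const.mul (he x)
  -- a point where `(u - m)² > 0`
  obtain ⟨w, hw⟩ : ∃ w, 0 < (u w - m) ^ 2 := by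
    by_cases h0 : u z₀ = m
    · refine ⟨z₁, ?_⟩
      have : u z₁ - m ≠ 0 := by
        intro h; apply hne; show u z₀ = u z₁; linarith
      positivity
    · exact ⟨z₀, by have : u z₀ - m ≠ 0 := sub_ne_zero.2 h0; positivity⟩
  refine pinnedChain_integral_gibbsMeasure_pos hω hl hβ hT ((huc.sub continuous_const).pow 2)
    (fun z => sq_nonneg _) hw ?_
  -- integrability of `(u - m)² e^{-H/T}`
  have hub : ∀ y, |u y| ≤ (∑ x, |ξ x| * C) * Real.exp (ϑ * P.hamiltonian N y) :=
    fun y => abs_sum_mul_le_exp_bound Finset.univ heb ξ y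
  set K : ℝ := ∑ x, |ξ x| * C with hK
  have hK0 : 0 ≤ K := Finset.sum_nonneg fun x _ => mul_nonneg (abs_nonneg _) hC
  have hmb : ∀ y, |m| ≤ |m| * Real.exp (ϑ * P.hamiltonian N y) := fun y =>
    le_mul_of_one_le_right (abs_nonneg _)
      (Real.one_le_exp (mul_nonneg hϑ0.le (pinnedChain_hamiltonian_nonneg hω.le hl hβ γ N y)))
  have hdb : ∀ y, |u y - m| ≤ (K + |m|) * Real.exp (ϑ * P.hamiltonian N y) := fun y => by
    calc |u y - m| ≤ |u y| + |m| := abs_sub _ _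
      _ ≤ K * Real.exp (ϑ * P.hamiltonian N y) + |m| * Real.exp (ϑ * P.hamiltonian N y) :=
          add_le_add (hub y) (hmb y)
      _ = (K + |m|) * Real.exp (ϑ * P.hamiltonian N y) := by ring
  have hsqb : ∀ y, |(u y - m) ^ 2| ≤ (K + |m|) ^ 2 * Real.exp (2 * ϑ * P.hamiltonian N y) := fun y => by
    rw [abs_pow, show (K + |m|) ^ 2 * Real.exp (2 * ϑ * P.hamiltonian N y) =
      ((K + |m|) * Real.exp (ϑ * P.hamiltonian N y)) ^ 2 by rw [mul_pow, ← Real.exp_nat_mul]; ring_nf]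
    exact pow_le_pow_left₀ (abs_nonneg _) (hdb y) 2
  have hw2 := pinnedChain_integrable_exp_mul_gibbsDensity hω hl hβ γ N hT h2ϑ
  refine (hw2.const_mul ((K + |m|) ^ 2)).mono'
    ((((huc.sub continuous_const).pow 2).mul (pinnedChain_continuous_gibbsDensity ω₂ lam β γ N T)).aestronglyMeasurable)
    (Eventually.of_forall fun y => ?_)
  rw [Real.norm_eq_abs, abs_mul, abs_of_pos (P.gibbsDensity_pos N T y), ← mul_assoc]
  exact mul_le_mul_of_nonneg_right (hsqb y) (P.gibbsDensity_pos N T y).le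

end Pinned

end Summit.AtomisticToContinuum.FouriersLaw.Theorems.HonestZwanzig

end
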